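import Literature.Probability.Percolation.TwoClusterConditionalAssociation
import Literature.Probability.Percolation.KozmaNitzanSeparatingTriple
import HarnessLib

/-!
# The jointly-conditioned observer constant is at most the single-pair value: `p̂ ≤ p⋆` (PAPER-2 track (ii): constants of the CSH family)

builds on p205010 (kernel theorem, internal audit signed; external expert review pending).  Support file (`--supports
stmt-CriticalPhenomena-4575`), seat `prim-consts-2`; rows A6/A11 of `run/shared/lean/prim/consts/CONSTANTS.md`.  No definitions, no named facts,
no sorries.

Three observer constants for the level-0 covariance transfer MDL(X) (owner `x`, avoided set `Y`, observers `o, v`; `μ = prodBernoulli w`):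
the tree's `p = P(o ∈ C_v | v ↮ {x} ∪ Y)` (admissible, `CSH.cshMargin_nil_nonneg`), the jointly-conditioned
`p̂ = P(o ∈ C_v | v ↮ {x} ∪ Y, x ↮ Y)` (`Consts.MDLXJoint` conjectures it admissible; `p ≤ p̂` is `Consts.jointObserverConst_ge`), and the single-pair value
`p⋆ = [P(o ∈ C_x ∪ C_v | x ↮ Y, v ↮ Y) − P(o ∈ C_x | x ↮ Y)] / P(v ∉ C_x | x ↮ Y)` (an upper bound for every admissible constant,
`Consts.singleEdge_not_improvable`; conjecturally THE sharp constant — "single-edge extremality", prim-paper-s3 F7).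

* `Consts.jointObsConst_le_singleEdgeConst` — **THEOREM: `p̂ ≤ p⋆`** on every finite weighted graph, denominator-free:
  `μ(𝒜 ∩ D ∩ {v ↔ o}) · [μ(D₁) · μ(D ∩ {x ↮ v})] ≤ μ(𝒜 ∩ D) · [μ(D) · μ(D₁ ∩ O) − μ(D₁) · μ(D ∩ {x ↔ o})]`
  (`𝒜 = {v ↮ {x} ∪ Y}`, `D = {x ↮ Y}`, `D₁ = {x ↮ Y} ∩ {v ↮ Y}`, `O = {x ↔ o} ∪ {v ↔ o}`).
  So `p ≤ p̂ ≤ p⋆`, and single-edge extremality IMPLIES `Consts.MDLXJoint` (which implies MDL(X), `Consts.mdlx_of_mdlxJoint`).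
  Proof.  With `h = μ(D₁ ∩ {x↔v})` (`= μ(D ∩ {x↔v})`), `n = μ(D ∩ {x↮v})`, `n₁ = μ(D₁ ∩ {x↮v})`, `α_B = μ(D₁ ∩ {x↔v} ∩ {x↔o})`,
  `α₀ = μ(D ∩ {x↮v} ∩ {x↔o})`, `α₀₁ = μ(D₁ ∩ {x↮v} ∩ {x↔o})`, `ŵ = μ(D₁ ∩ {x↮v} ∩ {v↔o})` the claim is the sum of
  `(h + n₁) · [n α₀₁ − n₁ α₀] ≥ 0` — van den Berg–Häggström–Kahn Thm 1.4 with sets (`{o ∈ C_x}` and `{v ↔ Y}` are negatively correlated given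
  `x ↮ Y ∪ {v}`) — and `(n − n₁) · [n₁ α_B − h (α₀₁ + ŵ)] ≥ 0` — Thm 1.3 with sets (`{x ↔ v}` and `{o ∈ C_x ∪ C_v}` are positively
  correlated given `{x, v} ↮ Y`).
[cite: VandenbergHaggstromKahn2005, Thm. 1.3 (p. 6), Thm. 1.4 (p. 7) with Remark 1 after Thm. 1.2 (p. 5); KozmaNitzan2024 §2.2 p. 5]
-/

noncomputable section

namespace Summit.CriticalPhenomena.PercolationContinuityZ3.Theorems

open MeasureTheory Set Literature.Probability.LatticeModels Literature.Probability.Percolation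
open scoped Classical

namespace Consts

variable {V : Type*} [Fintype V]

/-- **THEOREM (`p̂ ≤ p⋆`).**  For every finite weighted graph (`μ = prodBernoulli w`), owner `x`, avoided set `Y`, observers `o, v`:
`μ(𝒜 ∩ D ∩ {v ↔ o}) · [μ(D₁) μ(D ∩ {x ↮ v})] ≤ μ(𝒜 ∩ D) · [μ(D) μ(D₁ ∩ ({x ↔ o} ∪ {v ↔ o})) − μ(D₁) μ(D ∩ {x ↔ o})]`, where
`𝒜 = {v ↮ {x} ∪ Y}`, `D = {x ↮ Y}`, `D₁ = {x ↮ Y} ∩ {v ↮ Y}`; i.e. the jointly-conditioned observer constant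
`p̂ = μ(𝒜 ∩ D ∩ {v ↔ o}) / μ(𝒜 ∩ D)` of `Consts.MDLXJoint` is at most the single-pair value `p⋆` of `Consts.singleEdge_not_improvable`.
[cite: VandenbergHaggstromKahn2005, Thm. 1.3 (p. 6), Thm. 1.4 (p. 7) with Remark 1 after Thm. 1.2 (p. 5)] -/
theorem jointObsConst_le_singleEdgeConst (w : Sym2 V → unitInterval) (x o v : V) (Y : Set V) :
    (prodBernoulli w).real ({ω : BondConfig V | ∀ a ∈ insert x Y, ¬ (openGraph ω).Reachable v a} ∩
          {ω | ∀ y ∈ Y, ¬ (openGraph ω).Reachable x y} ∩ openConn v o) *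
        ((prodBernoulli w).real
            {ω : BondConfig V | ∀ y ∈ Y, ¬ (openGraph ω).Reachable x y ∧ ¬ (openGraph ω).Reachable v y} *
          (prodBernoulli w).real
            ({ω : BondConfig V | ∀ y ∈ Y, ¬ (openGraph ω).Reachable x y} ∩ {ω | ¬ (openGraph ω).Reachable x v})) ≤
      (prodBernoulli w).real ({ω : BondConfig V | ∀ a ∈ insert x Y, ¬ (openGraph ω).Reachable v a} ∩
          {ω | ∀ y ∈ Y, ¬ (openGraph ω).Reachable x y}) *
        ((prodBernoulli w).real {ω : BondConfig V | ∀ y ∈ Y, ¬ (openGraph ω).Reachable x y} *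
            (prodBernoulli w).real
              ({ω : BondConfig V | ∀ y ∈ Y, ¬ (openGraph ω).Reachable x y ∧ ¬ (openGraph ω).Reachable v y} ∩
                (openConn x o ∪ openConn v o)) -
          (prodBernoulli w).real
              {ω : BondConfig V | ∀ y ∈ Y, ¬ (openGraph ω).Reachable x y ∧ ¬ (openGraph ω).Reachable v y} *
            (prodBernoulli w).real ({ω : BondConfig V | ∀ y ∈ Y, ¬ (openGraph ω).Reachable x y} ∩ openConn x o)) := by
  classical
  set μ := prodBernoulli w with hμ
  have hmeas : ∀ U : Set (BondConfig V), MeasurableSet U := fun _ => MeasurableSet.of_discrete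
  set D : Set (BondConfig V) := {ω | ∀ y ∈ Y, ¬ (openGraph ω).Reachable x y} with hD
  set D₁ : Set (BondConfig V) := {ω | ∀ y ∈ Y, ¬ (openGraph ω).Reachable x y ∧ ¬ (openGraph ω).Reachable v y} with hD₁
  set 𝒜 : Set (BondConfig V) := {ω | ∀ a ∈ insert x Y, ¬ (openGraph ω).Reachable v a} with h𝒜
  set N : Set (BondConfig V) := {ω | ¬ (openGraph ω).Reachable x v} with hN
  set H : Set (BondConfig V) := openConn x v with hH
  set A : Set (BondConfig V) := openConn x o with hA
  set W : Set (BondConfig V) := openConn v o with hW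
  set D' : Set (BondConfig V) := {ω | ∀ t ∈ insert v Y, ¬ (openGraph ω).Reachable x t} with hD'
  set VY : Set (BondConfig V) := {ω | ∃ y ∈ Y, (openGraph ω).Reachable v y} with hVY
  -- set identities (all by membership chasing)
  have s1 : 𝒜 ∩ D = D₁ ∩ N := by
    ext ω
    simp only [h𝒜, hD, hD₁, hN, mem_inter_iff, mem_setOf_eq, mem_insert_iff, forall_eq_or_imp]
    constructor
    · rintro ⟨⟨hvx, hvY⟩, hxY⟩
      exact ⟨fun y hy => ⟨hxY y hy, hvY y hy⟩, fun h => hvx h.symm⟩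
    · rintro ⟨h, hxv⟩
      exact ⟨⟨fun h' => hxv h'.symm, fun y hy => (h y hy).2⟩, fun y hy => (h y hy).1⟩
  have s2 : D ∩ N = D' := by
    ext ω
    simp only [hD, hN, hD', mem_inter_iff, mem_setOf_eq, mem_insert_iff, forall_eq_or_imp]
    tauto
  have sDH : D \ H = D ∩ N := Set.ext fun ω => Iff.rfl
  have sD₁H : D₁ \ H = D₁ ∩ N := Set.ext fun ω => Iff.rfl
  have s4 : D ∩ H = D₁ ∩ H := by
    ext ω
    simp only [hD, hD₁, mem_inter_iff, mem_setOf_eq]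
    constructor
    · rintro ⟨h, hxv⟩
      exact ⟨fun y hy => ⟨h y hy, fun hvy => h y hy ((show (openGraph ω).Reachable x v from hxv).trans hvy)⟩, hxv⟩
    · rintro ⟨h, hxv⟩
      exact ⟨fun y hy => (h y hy).1, hxv⟩
  have sDAH : D ∩ A ∩ H = D₁ ∩ H ∩ A := by
    rw [inter_right_comm, s4]
  have sDAN : (D ∩ A) \ H = D ∩ N ∩ A := by
    ext ω; simp only [mem_sdiff, mem_inter_iff]; constructor
    · rintro ⟨⟨hd, ha⟩, hh⟩; exact ⟨⟨hd, hh⟩, ha⟩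
    · rintro ⟨⟨hd, hh⟩, ha⟩; exact ⟨⟨hd, ha⟩, hh⟩
  have sD₁OH : D₁ ∩ (A ∪ W) ∩ H = D₁ ∩ H ∩ A := by
    ext ω
    simp only [mem_inter_iff, mem_union]
    constructor
    · rintro ⟨⟨hd, hxo | hvo⟩, hxv⟩
      · exact ⟨⟨hd, hxv⟩, hxo⟩
      · exact ⟨⟨hd, hxv⟩, show (openGraph ω).Reachable x o from
          (show (openGraph ω).Reachable x v from hxv).trans hvo⟩
    · rintro ⟨⟨hd, hxv⟩, hxo⟩
      exact ⟨⟨hd, Or.inl hxo⟩, hxv⟩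
  have sD₁HO : D₁ ∩ (H ∩ (A ∪ W)) = D₁ ∩ H ∩ A := by
    rw [← sD₁OH, inter_assoc, inter_comm H]
  have sD₁ON : (D₁ ∩ (A ∪ W)) \ H = (D₁ ∩ N ∩ A) ∪ (D₁ ∩ N ∩ W) := by
    ext ω
    simp only [mem_sdiff, mem_inter_iff, mem_union]
    constructor
    · rintro ⟨⟨hd, hxo | hvo⟩, hh⟩
      · exact Or.inl ⟨⟨hd, hh⟩, hxo⟩
      · exact Or.inr ⟨⟨hd, hh⟩, hvo⟩
    · rintro (⟨⟨hd, hh⟩, hxo⟩ | ⟨⟨hd, hh⟩, hvo⟩)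
      · exact ⟨⟨hd, Or.inl hxo⟩, hh⟩
      · exact ⟨⟨hd, Or.inr hvo⟩, hh⟩
  have s6 : Disjoint (D₁ ∩ N ∩ A) (D₁ ∩ N ∩ W) := by
    rw [Set.disjoint_left]
    rintro ω ⟨⟨-, hxv⟩, hxo⟩ ⟨-, hvo⟩
    exact hxv ((show (openGraph ω).Reachable x o from hxo).trans (show (openGraph ω).Reachable v o from hvo).symm)
  have sD'VY : D' \ VY = D₁ ∩ N := by
    ext ω
    simp only [hD', hVY, hD₁, hN, mem_sdiff, mem_inter_iff, mem_setOf_eq, mem_insert_iff, forall_eq_or_imp, not_exists, not_and]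
    constructor
    · rintro ⟨⟨hxv, hxY⟩, hvY⟩
      exact ⟨fun y hy => ⟨hxY y hy, hvY y hy⟩, hxv⟩
    · rintro ⟨h, hxv⟩
      exact ⟨⟨hxv, fun y hy => (h y hy).1⟩, fun y hy => (h y hy).2⟩
  have sD'AVY : (D' ∩ A) \ VY = D₁ ∩ N ∩ A := by
    rw [← sD'VY]
    ext ω; simp only [mem_sdiff, mem_inter_iff]; tauto
  -- masses
  set h : ℝ := μ.real (D₁ ∩ H) with hh
  set n : ℝ := μ.real (D ∩ N) with hn
  set n₁ : ℝ := μ.real (D₁ ∩ N) with hn₁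
  set αB : ℝ := μ.real (D₁ ∩ H ∩ A) with hαB
  set α₀ : ℝ := μ.real (D ∩ N ∩ A) with hα₀
  set α₀₁ : ℝ := μ.real (D₁ ∩ N ∩ A) with hα₀₁
  set ŵ : ℝ := μ.real (D₁ ∩ N ∩ W) with hŵ
  have md : μ.real D = h + n := by
    have e := measureReal_inter_add_sdiff (μ := μ) (s := D) (hmeas H)
    rw [s4, sDH] at e
    exact e.symm
  have md₁ : μ.real D₁ = h + n₁ := by
    have e := measureReal_inter_add_sdiff (μ := μ) (s := D₁) (hmeas H)
    rw [sD₁H] at e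
    exact e.symm
  have mDA : μ.real (D ∩ A) = αB + α₀ := by
    have e := measureReal_inter_add_sdiff (μ := μ) (s := D ∩ A) (hmeas H)
    rw [sDAH, sDAN] at e
    exact e.symm
  have mD₁O : μ.real (D₁ ∩ (A ∪ W)) = αB + (α₀₁ + ŵ) := by
    have e := measureReal_inter_add_sdiff (μ := μ) (s := D₁ ∩ (A ∪ W)) (hmeas H)
    rw [sD₁OH, sD₁ON, measureReal_union s6 (hmeas _)] at e
    exact e.symm
  have m𝒜D : μ.real (𝒜 ∩ D) = n₁ := by rw [s1]
  have m𝒜DW : μ.real (𝒜 ∩ D ∩ W) = ŵ := by rw [s1]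
  -- (ii) vdBHK Thm 1.4 with sets: `α₀ · n₁ ≤ α₀₁ · n`
  have h2 : α₀ * n₁ ≤ α₀₁ * n := by
    set G : Set (Sym2 V) → ℝ := fun C => if (∃ y ∈ Y, (openGraph C).Reachable v y) then (1 : ℝ) else 0 with hG
    have hGm : Monotone G := by
      refine TripodExchange.predIndicator_monotone ?_
      rintro C C' hCC' ⟨y, hy, hr⟩
      exact ⟨y, hy, hr.mono (openGraph_mono hCC')⟩
    have hcond : {ω : BondConfig V | ∀ s ∈ ({x} : Set V), ∀ t ∈ insert v Y, ¬ (openGraph ω).Reachable s t} = D' := by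
      ext ω; simp only [hD', mem_setOf_eq, mem_singleton_iff, forall_eq]
    have hFω : ∀ ω : BondConfig V, connIndicatorFn x o (⋃ a ∈ ({x} : Set V), openEdgeCluster ω a) = A.indicator 1 ω := by
      intro ω
      have e : (⋃ a ∈ ({x} : Set V), openEdgeCluster ω a) = openEdgeCluster ω x := by ext d; simp
      rw [e, hA, connIndicatorFn_openEdgeCluster]
    have hvT : v ∈ insert v Y := mem_insert v Y
    have hGω : ∀ ω : BondConfig V, G (⋃ t ∈ insert v Y, openEdgeCluster ω t) = VY.indicator 1 ω := by
      intro ω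
      have hiff : (∃ y ∈ Y, (openGraph (⋃ t ∈ insert v Y, openEdgeCluster ω t)).Reachable v y) ↔
          ∃ y ∈ Y, (openGraph ω).Reachable v y := by
        constructor
        · rintro ⟨y, hy, hr⟩; exact ⟨y, hy, (KNSep.reachable_iff_cluster ω (insert v Y) hvT y).2 hr⟩
        · rintro ⟨y, hy, hr⟩; exact ⟨y, hy, (KNSep.reachable_iff_cluster ω (insert v Y) hvT y).1 hr⟩
      simp only [hG, hiff]
      exact TwoSetConditionalAssociation.predIndicator_eq_indicator (fun ω' => ∃ y ∈ Y, (openGraph ω').Reachable v y) ω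
    have key := BHK2006_twoSetConditionalAssociation.negCorrelation w {x} (insert v Y) (connIndicatorFn x o) G
      (monotone_connIndicatorFn x o) hGm
    simp only [hcond, hFω, hGω, TripodExchange.setIntegral_indicator_one_eq,
      TripodExchange.setIntegral_indicator_mul_indicator_eq] at key
    -- key : μ(D') · μ(D' ∩ (A ∩ VY)) ≤ μ(D' ∩ A) · μ(D' ∩ VY)
    have eα₀ : μ.real (D' ∩ A) = α₀ := by rw [← s2]
    have en : μ.real D' = n := by rw [← s2]
    have eA : μ.real (D' ∩ (A ∩ VY)) + α₀₁ = α₀ := by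
      have e := measureReal_inter_add_sdiff (μ := μ) (s := D' ∩ A) (hmeas VY)
      rw [inter_assoc, sD'AVY, eα₀] at e
      exact e
    have eD : μ.real (D' ∩ VY) + n₁ = n := by
      have e := measureReal_inter_add_sdiff (μ := μ) (s := D') (hmeas VY)
      rw [sD'VY, en] at e
      exact e
    have hX : μ.real (D' ∩ (A ∩ VY)) = α₀ - α₀₁ := by linarith
    have hP : μ.real (D' ∩ VY) = n - n₁ := by linarith
    rw [eα₀, en, hX, hP] at key
    nlinarith [key]
  -- (iii) vdBHK Thm 1.3 with sets for the source set `{x, v}`: `h · (α₀₁ + ŵ) ≤ n₁ · αB`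
  have h3 : h * (α₀₁ + ŵ) ≤ n₁ * αB := by
    set F : Set (Sym2 V) → ℝ := fun K => if (openGraph K).Reachable x v then (1 : ℝ) else 0 with hF
    set G : Set (Sym2 V) → ℝ := fun K => if ((openGraph K).Reachable x o ∨ (openGraph K).Reachable v o) then (1 : ℝ) else 0 with hG
    have hFm : Monotone F := TripodExchange.predIndicator_monotone fun K K' hKK' hr => hr.mono (openGraph_mono hKK')
    have hGm : Monotone G := by
      refine TripodExchange.predIndicator_monotone ?_
      rintro K K' hKK' (hr | hr)
      · exact Or.inl (hr.mono (openGraph_mono hKK'))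
      · exact Or.inr (hr.mono (openGraph_mono hKK'))
    have hxS : x ∈ ({x, v} : Set V) := mem_insert x {v}
    have hvS : v ∈ ({x, v} : Set V) := mem_insert_of_mem x rfl
    have hcond : {ω : BondConfig V | ∀ s ∈ ({x, v} : Set V), ∀ t ∈ Y, ¬ (openGraph ω).Reachable s t} = D₁ := by
      ext ω
      simp only [hD₁, mem_setOf_eq, mem_insert_iff, mem_singleton_iff, forall_eq_or_imp, forall_eq]
      exact ⟨fun hh y hy => ⟨hh.1 y hy, hh.2 y hy⟩, fun hh => ⟨fun y hy => (hh y hy).1, fun y hy => (hh y hy).2⟩⟩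
    have hFω : ∀ ω : BondConfig V, F (⋃ s ∈ ({x, v} : Set V), openEdgeCluster ω s) = H.indicator 1 ω := by
      intro ω
      have hiff : (openGraph (⋃ s ∈ ({x, v} : Set V), openEdgeCluster ω s)).Reachable x v ↔ (openGraph ω).Reachable x v :=
        (KNSep.reachable_iff_cluster ω {x, v} hxS v).symm
      simp only [hF, hiff]
      exact TwoSetConditionalAssociation.predIndicator_eq_indicator (fun ω' => (openGraph ω').Reachable x v) ω
    have hGω : ∀ ω : BondConfig V, G (⋃ s ∈ ({x, v} : Set V), openEdgeCluster ω s) = (A ∪ W).indicator 1 ω := by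
      intro ω
      have hiff : ((openGraph (⋃ s ∈ ({x, v} : Set V), openEdgeCluster ω s)).Reachable x o ∨
          (openGraph (⋃ s ∈ ({x, v} : Set V), openEdgeCluster ω s)).Reachable v o) ↔
          ((openGraph ω).Reachable x o ∨ (openGraph ω).Reachable v o) := by
        rw [← KNSep.reachable_iff_cluster ω {x, v} hxS o, ← KNSep.reachable_iff_cluster ω {x, v} hvS o]
      simp only [hG, hiff]
      exact TwoSetConditionalAssociation.predIndicator_eq_indicator (fun ω' => (openGraph ω').Reachable x o ∨ (openGraph ω').Reachable v o) ω
    have key := BHK2006_setClusterConditionalPositiveAssociation w {x, v} Y F G hFm hGm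
    simp only [hcond, hFω, hGω, TripodExchange.setIntegral_indicator_one_eq,
      TripodExchange.setIntegral_indicator_mul_indicator_eq] at key
    -- key : μ(D₁ ∩ H) · μ(D₁ ∩ (A ∪ W)) ≤ μ(D₁) · μ(D₁ ∩ (H ∩ (A ∪ W)))
    rw [sD₁HO, mD₁O, md₁] at key
    nlinarith [key]
  -- (i) `n₁ ≤ n`, signs, and the certificate `target = (h + n₁)(n α₀₁ − n₁ α₀) + (n − n₁)(n₁ αB − h(α₀₁ + ŵ))`
  have hn₁n : n₁ ≤ n := by
    refine measureReal_mono ?_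
    rintro ω ⟨hω, hω'⟩; exact ⟨fun y hy => (hω y hy).1, hω'⟩
  have hh0 : 0 ≤ h := measureReal_nonneg
  have hn₁0 : 0 ≤ n₁ := measureReal_nonneg
  rw [m𝒜DW, m𝒜D, md, md₁, mDA, mD₁O]
  have t1 : 0 ≤ (h + n₁) * (n * α₀₁ - n₁ * α₀) := mul_nonneg (by linarith) (by linarith)
  have t2 : 0 ≤ (n - n₁) * (n₁ * αB - h * (α₀₁ + ŵ)) := mul_nonneg (by linarith) (by linarith)
  nlinarith [t1, t2]

end Consts

end Summit.CriticalPhenomena.PercolationContinuityZ3.Theorems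

end
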